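import Mathlib
import HarnessLib

/-!
# LINE (A) `product_plus_one` (crux `MatrixDescartes`, stmt-ValiantsHypothesis-18050, V1) — EB2-W bookkeeping, brick G5a:
# the WINDOW-TO-GLOBAL SHELL WITH CHARGES («≤ A + 2·n(window) roots per window ⇒ Z₊(W) ≤ Σ_windows (A + 2·n) + #cuts»)

Pen val-idea-25 g5 BY-NAME 10 (2026-08-29 08:33Z), accounting sentence (ACC‴): per pole-free window `I` of a company, `Z(W | I) ≤ A + 2·F_I` with a window
CHARGE `F_I` (fast features centred in `I`); globally the charges add up.  This file is the pure counting half, for ANY real polynomial `W` and ANY finite set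
of positive CUT POINTS `C` (in the applications: the positive roots of `P = ∏ fewnomial`):

* windows are indexed by their LEFT ENDPOINT `a ∈ insert 0 C`; `t` lies in the window of `a` iff `a < t` and no cut point lies in `(a, t]`
  (`fun t => a < t ∧ ∀ c ∈ C, ¬ (a < c ∧ c ≤ t)`; the last window is unbounded);
* ★ `card_posRoots_le_sum_windows` — if for every `a ∈ insert 0 C` the window of `a` holds at most `B a` positive roots of `W`, then
  `Z₊(W) ≤ Σ_{a ∈ insert 0 C} B a + C.card` (the `C.card` pays for roots of `W` AT cut points; union bound, no disjointness needed);
* `card_posRoots_le_linear_of_charges` — the (ACC‴) shape: `B a = A + 2·n a` ⇒ `Z₊(W) ≤ (C.card + 1)·A + 2·Σ n a + C.card`;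
* `mem_window_iff` — the window predicate unfolded (`a < t ∧ ∀ c ∈ C, c ≤ a ∨ t < c`), for plugging per-window cells stated on open intervals `(u,v)`.
* ★ G5b `card_posRoots_le_of_window_charges` — the shape with `m` rows: `C.card ≤ m` (for `C = Z₊(∏_j fewnomial d (a j))` of a one-change `K = 3` company
  this is ✓ `card_posRoots_prod_le_of_oneChange`) ⇒ `Z₊(W) ≤ (m + 1)·A + 2·Σ_{a} n a + m` — EB2-W's inequality with constant `A + 1` plus twice the total charge
  (linear as soon as the charges add up to `O(m)`, e.g. `n a` = # fast features centred in the window of `a`, total ≤ m); the cells of record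
  (✓ G3 `rateSeparated_wronskian_roots_le_two`, E3b `sixthOrder_ringfree_wronskian_roots_le_six`, E5′ when it lands) plug into `hwin` by name, window by
  window (`window_free_of_posRoots` gives the pole-freeness they need).

HONEST FRAMING: finset bookkeeping; proves nothing about `WronskianBudgetK3` / `OneChangeFloorK3` / the stubs / 18050 / `MatrixDescartes` / B by itself ((ACC‴)'s per-window
law is located, not proved); `VP ≠ VNP` is NOT proved.  No definitions, no named facts, no sorry; Mathlib + HarnessLib only.
-/

set_option linter.dupNamespace false

namespace Summit.ValiantsHypothesis.ValiantsHypothesis.Theorems.LacunarySymmetroidMatrixDescartes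

namespace ProductPlusOne

open Finset Polynomial

/-- The window predicate unfolded: `t` is in the window right of `a` iff `a < t` and every cut point is `≤ a` or `> t`. [folklore] -/
theorem mem_window_iff (C : Finset ℝ) (a t : ℝ) :
    (a < t ∧ ∀ c ∈ C, ¬ (a < c ∧ c ≤ t)) ↔ (a < t ∧ ∀ c ∈ C, c ≤ a ∨ t < c) := by
  constructor
  · rintro ⟨hat, h⟩
    refine ⟨hat, fun c hc => ?_⟩
    by_contra hno
    push Not at hno
    exact h c hc ⟨hno.1, hno.2⟩
  · rintro ⟨hat, h⟩
    refine ⟨hat, fun c hc ⟨hac, hct⟩ => ?_⟩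
    rcases h c hc with h' | h'
    · exact absurd hac (not_lt.2 h')
    · exact absurd hct (not_le.2 h')

/-- **Every positive point off the cuts lies in the window of some left endpoint `a ∈ insert 0 C`** (`a` = the largest cut below `t`, or `0`). [folklore] -/
theorem exists_window_of_pos (C : Finset ℝ) {t : ℝ} (ht : 0 < t) (htC : t ∉ C) :
    ∃ a ∈ insert (0 : ℝ) C, a < t ∧ ∀ c ∈ C, ¬ (a < c ∧ c ≤ t) := by
  classical
  set S := C.filter (fun c => c < t) with hS
  rcases S.eq_empty_or_nonempty with h0 | hne
  · refine ⟨0, Finset.mem_insert_self _ _, ht, fun c hc ⟨_, hct⟩ => ?_⟩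
    have hlt : c < t := lt_of_le_of_ne hct (fun h => htC (h ▸ hc))
    have : c ∈ S := Finset.mem_filter.2 ⟨hc, hlt⟩
    rw [h0] at this; exact absurd this (Finset.notMem_empty c)
  · refine ⟨S.max' hne, Finset.mem_insert_of_mem (Finset.mem_of_mem_filter _ (S.max'_mem hne)), (Finset.mem_filter.1 (S.max'_mem hne)).2,
      fun c hc ⟨hac, hct⟩ => ?_⟩
    have hlt : c < t := lt_of_le_of_ne hct (fun h => htC (h ▸ hc))
    have : c ∈ S := Finset.mem_filter.2 ⟨hc, hlt⟩
    exact absurd (S.le_max' c this) (not_le.2 hac)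

/-- ★ **WINDOW-TO-GLOBAL SHELL.**  `W` a real polynomial, `C` a finite set of cut points; if for every left endpoint `a ∈ insert 0 C` the window of `a`
carries at most `B a` positive roots of `W`, then `Z₊(W) ≤ Σ_{a ∈ insert 0 C} B a + C.card`. [this file's theorem] -/
theorem card_posRoots_le_sum_windows (W : ℝ[X]) (C : Finset ℝ) (B : ℝ → ℕ)
    (hwin : ∀ a ∈ insert (0 : ℝ) C,
      ((W.roots.toFinset.filter (fun t => 0 < t)).filter (fun t => a < t ∧ ∀ c ∈ C, ¬ (a < c ∧ c ≤ t))).card ≤ B a) :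
    (W.roots.toFinset.filter (fun t => 0 < t)).card ≤ (∑ a ∈ insert (0 : ℝ) C, B a) + C.card := by
  classical
  set ZW := W.roots.toFinset.filter (fun t => 0 < t) with hZW
  -- split off the roots at cut points
  have hsplit : ZW.card ≤ (ZW.filter (fun t => t ∉ C)).card + C.card := by
    have h1 := Finset.card_filter_add_card_filter_not (s := ZW) (fun t => t ∉ C)
    have h2 : (ZW.filter (fun t => ¬ (t ∉ C))).card ≤ C.card := by
      refine Finset.card_le_card (fun t ht => ?_)
      have := (Finset.mem_filter.1 ht).2
      push Not at this
      exact this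
    omega
  -- the off-cut roots are covered by the windows
  have hcover : ZW.filter (fun t => t ∉ C) ⊆
      (insert (0 : ℝ) C).biUnion (fun a => ZW.filter (fun t => a < t ∧ ∀ c ∈ C, ¬ (a < c ∧ c ≤ t))) := by
    intro t ht
    rw [Finset.mem_filter] at ht
    have htpos : 0 < t := (Finset.mem_filter.1 ht.1).2
    obtain ⟨a, ha, hwin'⟩ := exists_window_of_pos C htpos ht.2
    exact Finset.mem_biUnion.2 ⟨a, ha, Finset.mem_filter.2 ⟨ht.1, hwin'⟩⟩
  have hbU := (Finset.card_le_card hcover).trans Finset.card_biUnion_le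
  have hsum : ∑ a ∈ insert (0 : ℝ) C, (ZW.filter (fun t => a < t ∧ ∀ c ∈ C, ¬ (a < c ∧ c ≤ t))).card
      ≤ ∑ a ∈ insert (0 : ℝ) C, B a := Finset.sum_le_sum fun a ha => hwin a ha
  omega

/-- **The (ACC‴) shape**: per-window bound `A + 2·n a` ⇒ `Z₊(W) ≤ (C.card + 1)·A + 2·Σ n a + C.card` (if `0 ∉ C`; in the applications `C ⊂ (0,∞)`).
[this file's theorem] -/
theorem card_posRoots_le_linear_of_charges (W : ℝ[X]) (C : Finset ℝ) (hC : (0 : ℝ) ∉ C) (A : ℕ) (n : ℝ → ℕ)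
    (hwin : ∀ a ∈ insert (0 : ℝ) C,
      ((W.roots.toFinset.filter (fun t => 0 < t)).filter (fun t => a < t ∧ ∀ c ∈ C, ¬ (a < c ∧ c ≤ t))).card ≤ A + 2 * n a) :
    (W.roots.toFinset.filter (fun t => 0 < t)).card ≤ (C.card + 1) * A + 2 * (∑ a ∈ insert (0 : ℝ) C, n a) + C.card := by
  classical
  have h := card_posRoots_le_sum_windows W C (fun a => A + 2 * n a) hwin
  have hs : ∑ a ∈ insert (0 : ℝ) C, (A + 2 * n a) = (C.card + 1) * A + 2 * ∑ a ∈ insert (0 : ℝ) C, n a := by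
    rw [Finset.sum_add_distrib, Finset.sum_const, Finset.card_insert_of_notMem hC, ← Finset.mul_sum]
    simp [Nat.mul_comm]
  omega

/-- **Cut points = positive roots of `P`**: the window of `a` (for `C = Z₊(P)`) is a pole-free interval — every `t` in it has `P(t) ≠ 0`, and so does
every point strictly between `a` and `t`. [this file's lemma] -/
theorem window_free_of_posRoots (P : ℝ[X]) (hP : P ≠ 0) {a t : ℝ} (ha : 0 ≤ a)
    (hwin : a < t ∧ ∀ c ∈ P.roots.toFinset.filter (fun s => 0 < s), ¬ (a < c ∧ c ≤ t)) :
    ∀ y, a < y → y ≤ t → P.eval y ≠ 0 := by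
  intro y hay hyt hPy
  have hy : y ∈ P.roots.toFinset.filter (fun s => 0 < s) := by
    rw [Finset.mem_filter, Multiset.mem_toFinset, mem_roots hP]
    exact ⟨hPy, ha.trans_lt hay⟩
  exact hwin.2 y hy ⟨hay, hyt⟩

/-- ★ **G5b — THE SHAPE WITH `m` ROWS.**  If the cut set has at most `m` points (for `C = Z₊(∏_j fewnomial d (a j))` of a one-change `K = 3` company this
is ✓ `card_posRoots_prod_le_of_oneChange`), per-window bounds `A + 2·n a` give `Z₊(W) ≤ (m + 1)·A + 2·Σ_{a ∈ insert 0 C} n a + m` — EB2-W's inequality with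
constant `A + 1` plus twice the total charge; instantiate `W := W(∏ f)`, `C := Z₊(∏ f)` and feed each window's cell (✓ G3, E3b, E5′ …) into `hwin`
(`window_free_of_posRoots` supplies the pole-freeness). [this file's theorem] -/
theorem card_posRoots_le_of_window_charges (W : ℝ[X]) (C : Finset ℝ) (hC : (0 : ℝ) ∉ C) {m : ℕ} (hCm : C.card ≤ m) (A : ℕ) (n : ℝ → ℕ)
    (hwin : ∀ a ∈ insert (0 : ℝ) C,
      ((W.roots.toFinset.filter (fun t => 0 < t)).filter (fun t => a < t ∧ ∀ c ∈ C, ¬ (a < c ∧ c ≤ t))).card ≤ A + 2 * n a) :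
    (W.roots.toFinset.filter (fun t => 0 < t)).card ≤ (m + 1) * A + 2 * (∑ a ∈ insert (0 : ℝ) C, n a) + m := by
  have h := card_posRoots_le_linear_of_charges W C hC A n hwin
  have hmono : (C.card + 1) * A ≤ (m + 1) * A := Nat.mul_le_mul_right _ (by omega)
  omega

end ProductPlusOne

end Summit.ValiantsHypothesis.ValiantsHypothesis.Theorems.LacunarySymmetroidMatrixDescartes
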